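import Literature.MathematicalPhysics.QuantumFieldTheory.Balaban1983to89.T3DescentFibreTower
import HarnessLib

/-!
# `Balaban1983to89.T3MinimiserStabilityReduction` — rung R3, crux K1, child «MinimiserStability» (cell DAG node N6b «K1-E-min»):
# the constants `κ_K` of `MinimiserStabilityAt` are IDLE, finitely many approximations cost nothing, and the layer-3 reduction
# `MinimiserStabilityAt ⇐ constrained minimisers exist ∧ one-step comparison bounds ALONG minimisers`

Cell `ym3-torus` (HUMAN RULING D-0037, YM ladder rung R3), seat `ym3-torus-p1` gen 4 (UV side).  WHAT THIS IS NOT: not d = 4,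
not a mass gap, not Clay, and NOT the estimate `T3ConstrainedMinimiser.MinimiserStabilityAt` — every analytic statement below is a
HYPOTHESIS SCHEMA (never asserted); what is PROVED is the composition of the schemas into `MinimiserStabilityAt` and two
structural facts about that schema.

THE POINT.  `MinimiserStabilityAt F γ b₀ p₀ m` (p408691) compares, for one small datum `V` on the comparison lattice (finest
lattice of the `n`-th approximation, `n = ⌊K/m⌋`), the β-weighted constrained minimal Wilson actions of run `K+1` and run `K`
over the fibres `{U : D_{n,K+1}U = V}` and `{U : D_{n,K}U = V}`, modulo a `V`-independent constant `κ_K`.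
* §4 **`κ_K` IS IDLE** (`abs_const_le_of_minimiserStability`): the trivial datum `V = 1` is small and both constrained minima vanish
  there (`T3DescentFibreTower.minAction_one`), so `|κ_K| ≤ r_K`; hence `MinimiserStabilityAt ↔ MinimiserStabilityFreeAt` (the
  `κ ≡ 0` form, radii doubled; `0 < γ ≤ 1`, `b₀ > 0`).  **`minimiserStabilityAt_of_eventually`**: the inequality for `K ≥ K₀`
  suffices (a-priori `0 ≤ β_K·minAction ≤ β_K·2·#plaquettes`).
* §5 **THE REDUCTION**.  By the fibre tower (`T3DescentFibreTower.minAction_tower`) the comparison is a ONE-STEP statement, and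
  along MINIMISERS it splits into:  UPPER — every run-`K` minimiser `U_K(V)` has a run-`(K+1)` configuration in the fibre of
  `V` (an interpolation) with `β_{K+1}A ≤ β_K A(U_K) + r_K` (the cell's INTERP node N6bI, needed only along minimisers, where
  [Balaban1985Variational] Thm 1 (8)–(10) gives regularity);  LOWER — every run-`(K+1)` minimiser has a run-`K` configuration
  in the fibre of `V` (its block average) with `β_K A ≤ β_{K+1}A(U'_{K+1}) + r_K` (the cell's AVG-INEQ node N6bA,
  [Federbush1987PhaseCellIII] Thm 4.3-type local stability, along minimisers);  EXISTENCE of both minimisers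
  (`HasMinimisersAt`).  `minimiserStabilityAt_of_alongMinimisers` composes the three into `MinimiserStabilityAt`, and
  `unitTiltAt_of_alongMinimisers_fluctuation` continues to K1's body with `FluctuationComparisonAt` (p408691).
GAP-STATED (cell memo HOME/UV3-NODE.md §11): the tree's `minAction` is the GLOBAL fibre infimum, whereas [Balaban1985Variational]
Thm 1 concerns the minimum over the regular subspace `𝔘_k({Ω_j}, B₃ε₁)` (unique critical orbit in `𝔘_k({Ω_j}, ε₀)` only);
print controls `HasMinimisersAt`/`UpperAlongMinimisersAt` for the regular-space minimiser, not for the global one.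

References: T. Bałaban, «The variational problem and background fields in renormalization group method for lattice gauge
theories», Commun. Math. Phys. 102 (1985) 277–309 [Balaban1985Variational] (Thm 1 p.279); «Ultraviolet stability of
three-dimensional lattice pure gauge field theories», CMP 102 (1985) 255–275 [Balaban1985UV3] ((41) p.266: `U_k` = the minimum
of the action with the constraint; (7) p.257: `p(g)`); C. King, CMP 102 (1986) 649–677 [King1986] (App. (A.5): the abelian
minimiser is linear); P. Federbush, CMP 110 (1987) 293–309 [Federbush1987PhaseCellIII] (Thm 4.3: local stability of averaging).
-/

noncomputable section

open MeasureTheory Filter Topology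
open Literature.MathematicalPhysics.QuantumFieldTheory.Balaban1983to89.T3ContinuumYM3Torus
open Literature.MathematicalPhysics.QuantumFieldTheory.Balaban1983to89.T3LevelShift
open Literature.MathematicalPhysics.QuantumFieldTheory.Balaban1983to89.T3UnitLawDensityEML (ℰp measurableE_ℰp)
open Literature.MathematicalPhysics.QuantumFieldTheory.Balaban1983to89.T3UnitScaleTilt
open Literature.MathematicalPhysics.QuantumFieldTheory.Balaban1983to89.T3TiltDescent
open Literature.MathematicalPhysics.QuantumFieldTheory.Balaban1983to89.T3CruxEstimates
open Literature.MathematicalPhysics.QuantumFieldTheory.Balaban1983to89.T3ConstrainedMinimiser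
open Literature.MathematicalPhysics.QuantumFieldTheory.Balaban1983to89.T3DescentFibreTower
open Literature.MathematicalPhysics.QuantumFieldTheory.Balaban1983to89.Missing
open Literature.MathematicalPhysics.QuantumFieldTheory.Balaban1983to89.T4Continuum

namespace Literature.MathematicalPhysics.QuantumFieldTheory.Balaban1983to89.T3MinimiserStabilityReduction

/-! ## §4 The constants `κ_K` of `MinimiserStabilityAt` are idle; the trivial a-priori bound -/

section Idle

variable {P : Params} {j : ℕ} {G : Type*} [GaugeGroup G]

/-- A-priori bound: on a group with `|Re tr| ≤ 1` the unit-weight Wilson action is at most twice the number of plaquettes. [cite: Balaban1987RG1, (0.2) p.252] -/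
theorem wilsonAction4_le_two_mul_card [MeasurableSpace G] [RegularGaugeGroup G] (U : GaugeField P j G) :
    wilsonAction4 U ≤ 2 * Fintype.card (Plaq P j) := by
  unfold wilsonAction4 wilsonAction
  calc ∑ p : Plaq P j, (1 : ℝ) * (1 - reTr (GaugeField.plaqHol U p)) ≤ ∑ _p : Plaq P j, (2 : ℝ) :=
        Finset.sum_le_sum fun p _ => by
          have := RegularGaugeGroup.neg_one_le_reTr (GaugeField.plaqHol U p); linarith
    _ = 2 * Fintype.card (Plaq P j) := by rw [Finset.sum_const, Finset.card_univ, nsmul_eq_mul, mul_comm]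

variable (F : T3Family) (ℰ : LoopAverage G)

/-- A-priori bound for the constrained minimum: `0 ≤ minAction V ≤ 2·#plaquettes` (empty fibre: `sInf ∅ = 0`). [cite: Balaban1985UV3, (41) p.266] -/
theorem minAction_le_two_mul_card [MeasurableSpace G] [RegularGaugeGroup G] {n K : ℕ} (h : n ≤ K)
    (V : GaugeField (F.P n) 0 G) : minAction F ℰ n K h V ≤ 2 * Fintype.card (Plaq (F.P K) 0) := by
  by_cases hV : (fibre F ℰ n K h V).Nonempty
  · obtain ⟨U, hU⟩ := hV
    exact (minAction_le F ℰ hU).trans (wilsonAction4_le_two_mul_card U)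
  · have : (fun U => wilsonAction4 U) '' fibre F ℰ n K h V = ∅ := by
      rw [Set.image_eq_empty]; exact Set.not_nonempty_iff_eq_empty.mp hV
    unfold minAction
    rw [this, Real.sInf_empty]
    positivity

/-- **Bałaban's thresholds are positive**: `θ(i) = g_i p(g_i) > 0` for `0 < γ ≤ 1`, `b₀ > 0`, `L ≥ 1`. [cite: Balaban1985UV3, (7) p.257] -/
theorem θBal_pos {L : ℕ} (hL : 1 ≤ L) {γ b₀ : ℝ} (hγ : 0 < γ) (hγ1 : γ ≤ 1) (hb : 0 < b₀) (p₀ : ℝ) (i : ℕ) :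
    0 < θBal L γ b₀ p₀ i := by
  unfold θBal
  have hLi : 0 < ((L : ℝ)⁻¹) ^ i := pow_pos (inv_pos.mpr (by exact_mod_cast hL)) i
  have hLi1 : ((L : ℝ)⁻¹) ^ i ≤ 1 := pow_le_one₀ (inv_nonneg.mpr (Nat.cast_nonneg L))
    (inv_le_one_of_one_le₀ (by exact_mod_cast hL))
  have hx : 0 < γ * ((L : ℝ)⁻¹) ^ i := mul_pos hγ hLi
  have hx1 : γ * ((L : ℝ)⁻¹) ^ i ≤ 1 := by nlinarith
  have hs : 0 < Real.sqrt (γ * ((L : ℝ)⁻¹) ^ i) := Real.sqrt_pos.mpr hx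
  have hs1 : Real.sqrt (γ * ((L : ℝ)⁻¹) ^ i) ≤ 1 := Real.sqrt_le_one.mpr hx1
  -- `p(g) > 0` for `0 < g ≤ 1` (tree: `B10Eq47Volume.pFun_pos`, outside this file's import cone; two lines inline)
  refine mul_pos hs ?_
  unfold B10.pFun
  have hlog : 0 ≤ Real.log (Real.sqrt (γ * ((L : ℝ)⁻¹) ^ i))⁻¹ := Real.log_nonneg (one_le_inv_iff₀.mpr ⟨hs, hs1⟩)
  exact mul_pos hb (Real.rpow_pos_of_pos (by linarith) _)

/-- **THE CONSTANTS ARE IDLE**: any `(r, κ)` witnessing the inequality of `MinimiserStabilityAt` has `|κ_K| ≤ r_K` — evaluate at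
the trivial datum `V = 1`, which is small and has `minAction_{n,K}(1) = minAction_{n,K+1}(1) = 0` (§3). [cite: Balaban1985UV3, (41) p.266] -/
theorem abs_const_le_of_minimiserStability (F : T3Family) {γ b₀ p₀ : ℝ} (hγ : 0 < γ) (hγ1 : γ ≤ 1) (hb : 0 < b₀) {m : ℕ}
    {r κ : ℕ → ℝ}
    (h : ∀ K (V : GaugeField (F.P (K / m)) 0 (Matrix.specialUnitaryGroup (Fin 2) ℂ)), PlaqSmall (θBal F.L γ b₀ p₀ (K / m)) V →
      |(F.scheme ℰp γ).β (K + 1) * minAction F ℰp (K / m) (K + 1) ((Nat.div_le_self K m).trans (Nat.le_succ K)) V -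
          (F.scheme ℰp γ).β K * minAction F ℰp (K / m) K (Nat.div_le_self K m) V - κ K| ≤ r K)
    (K : ℕ) : |κ K| ≤ r K := by
  have h1 := h K 1 (plaqSmall_one (θBal_pos (F.hL.2.le) hγ hγ1 hb p₀ (K / m)))
  rwa [minAction_one F ℰp expMeanLogSU_E_one, minAction_one F ℰp expMeanLogSU_E_one, mul_zero, mul_zero, sub_zero,
    zero_sub, abs_neg] at h1

/-- **MINIMISER STABILITY, CONSTANT-FREE FORM** (hypothesis schema, never asserted): summable `r_K ≥ 0` with
`|β_{K+1}·minAction_{n,K+1}(V) − β_K·minAction_{n,K}(V)| ≤ r_K` for every small datum `V` on the comparison lattice, `n = ⌊K/m⌋` —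
`T3ConstrainedMinimiser.MinimiserStabilityAt` with `κ ≡ 0`; EQUIVALENT to it for `0 < γ ≤ 1`, `b₀ > 0`
(`minimiserStabilityAt_iff_constFree`). [cite: King1986, App. (A.5) p.676] -/
def MinimiserStabilityFreeAt (F : T3Family) (γ b₀ p₀ : ℝ) (m : ℕ) : Prop :=
  ∃ r : ℕ → ℝ, Summable r ∧ (∀ K, 0 ≤ r K) ∧
    ∀ K (V : GaugeField (F.P (K / m)) 0 (Matrix.specialUnitaryGroup (Fin 2) ℂ)), PlaqSmall (θBal F.L γ b₀ p₀ (K / m)) V →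
      |(F.scheme ℰp γ).β (K + 1) * minAction F ℰp (K / m) (K + 1) ((Nat.div_le_self K m).trans (Nat.le_succ K)) V -
          (F.scheme ℰp γ).β K * minAction F ℰp (K / m) K (Nat.div_le_self K m) V| ≤ r K

/-- The constant-free form implies `MinimiserStabilityAt` (take `κ ≡ 0`). [cite: King1986, App. (A.5) p.676] -/
theorem minimiserStabilityAt_of_constFree (F : T3Family) {γ b₀ p₀ : ℝ} {m : ℕ} (h : MinimiserStabilityFreeAt F γ b₀ p₀ m) :
    MinimiserStabilityAt F γ b₀ p₀ m := by
  obtain ⟨r, hr, hr0, h⟩ := h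
  exact ⟨r, fun _ => 0, hr, hr0, fun K V hV => by rw [sub_zero]; exact h K V hV⟩

/-- **`MinimiserStabilityAt ↔` its constant-free form** (`0 < γ ≤ 1`, `b₀ > 0`; radii `r ↦ 2r`): the `V`-independent constants
`κ_K` of the schema carry no freedom. [cite: King1986, App. (A.5) p.676] -/
theorem minimiserStabilityAt_iff_constFree (F : T3Family) {γ b₀ p₀ : ℝ} (hγ : 0 < γ) (hγ1 : γ ≤ 1) (hb : 0 < b₀) (m : ℕ) :
    MinimiserStabilityAt F γ b₀ p₀ m ↔ MinimiserStabilityFreeAt F γ b₀ p₀ m := by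
  refine ⟨fun ⟨r, κ, hr, hr0, h⟩ => ⟨fun K => 2 * r K, hr.mul_left 2, fun K => by linarith [hr0 K], fun K V hV => ?_⟩,
    minimiserStabilityAt_of_constFree F⟩
  have hκ := abs_const_le_of_minimiserStability F hγ hγ1 hb h K
  have h1 := h K V hV
  calc |(F.scheme ℰp γ).β (K + 1) * minAction F ℰp (K / m) (K + 1) _ V - (F.scheme ℰp γ).β K * minAction F ℰp (K / m) K _ V|
      = |((F.scheme ℰp γ).β (K + 1) * minAction F ℰp (K / m) (K + 1) ((Nat.div_le_self K m).trans (Nat.le_succ K)) V -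
          (F.scheme ℰp γ).β K * minAction F ℰp (K / m) K (Nat.div_le_self K m) V - κ K) + κ K| := by rw [sub_add_cancel]
    _ ≤ _ := abs_add_le _ _
    _ ≤ 2 * r K := by linarith

/-- **FINITELY MANY APPROXIMATIONS COST NOTHING**: if the inequality of `MinimiserStabilityAt` holds for `K ≥ K₀` with a summable
`r ≥ 0`, then `MinimiserStabilityAt` holds (below `K₀` use the a-priori bound `β·minAction ≤ β·2·#plaquettes`, `γ ≥ 0`). [cite: Balaban1985UV3, (41) p.266] -/
theorem minimiserStabilityAt_of_eventually (F : T3Family) {γ : ℝ} (hγ : 0 ≤ γ) (b₀ p₀ : ℝ) (m K₀ : ℕ) (r κ : ℕ → ℝ)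
    (hr : Summable r) (hr0 : ∀ K, 0 ≤ r K)
    (h : ∀ K, K₀ ≤ K → ∀ (V : GaugeField (F.P (K / m)) 0 (Matrix.specialUnitaryGroup (Fin 2) ℂ)), PlaqSmall (θBal F.L γ b₀ p₀ (K / m)) V →
      |(F.scheme ℰp γ).β (K + 1) * minAction F ℰp (K / m) (K + 1) ((Nat.div_le_self K m).trans (Nat.le_succ K)) V -
          (F.scheme ℰp γ).β K * minAction F ℰp (K / m) K (Nat.div_le_self K m) V - κ K| ≤ r K) :
    MinimiserStabilityAt F γ b₀ p₀ m := by
  -- the trivial bound `B K`, valid for every datum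
  set B : ℕ → ℝ := fun K => (F.scheme ℰp γ).β (K + 1) * (2 * Fintype.card (Plaq (F.P (K + 1)) 0)) +
    (F.scheme ℰp γ).β K * (2 * Fintype.card (Plaq (F.P K) 0)) + |κ K| with hB
  have hB0 : ∀ K, 0 ≤ B K := fun K =>
    add_nonneg (add_nonneg (mul_nonneg (F.scheme_β_nonneg ℰp hγ _) (by positivity))
      (mul_nonneg (F.scheme_β_nonneg ℰp hγ _) (by positivity))) (abs_nonneg _)
  have hBbd : ∀ K (V : GaugeField (F.P (K / m)) 0 (Matrix.specialUnitaryGroup (Fin 2) ℂ)),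
      |(F.scheme ℰp γ).β (K + 1) * minAction F ℰp (K / m) (K + 1) ((Nat.div_le_self K m).trans (Nat.le_succ K)) V -
          (F.scheme ℰp γ).β K * minAction F ℰp (K / m) K (Nat.div_le_self K m) V - κ K| ≤ B K := by
    intro K V
    have hβ := F.scheme_β_nonneg ℰp hγ K
    have hβ' := F.scheme_β_nonneg ℰp hγ (K + 1)
    have ha0 := minAction_nonneg F ℰp (K := K + 1) (h := (Nat.div_le_self K m).trans (Nat.le_succ K)) V
    have ha1 := minAction_le_two_mul_card F ℰp (K := K + 1) ((Nat.div_le_self K m).trans (Nat.le_succ K)) V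
    have hb0' := minAction_nonneg F ℰp (K := K) (h := Nat.div_le_self K m) V
    have hb1 := minAction_le_two_mul_card F ℰp (K := K) (Nat.div_le_self K m) V
    have e1 := mul_le_mul_of_nonneg_left ha1 hβ'
    have e2 := mul_le_mul_of_nonneg_left hb1 hβ
    have e3 := mul_nonneg hβ' ha0
    have e4 := mul_nonneg hβ hb0'
    show _ ≤ (F.scheme ℰp γ).β (K + 1) * (2 * Fintype.card (Plaq (F.P (K + 1)) 0)) +
      (F.scheme ℰp γ).β K * (2 * Fintype.card (Plaq (F.P K) 0)) + |κ K|
    have k1 := neg_abs_le (κ K)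
    have k2 := le_abs_self (κ K)
    refine abs_le.mpr ⟨?_, ?_⟩
    · linarith
    · linarith
  have hfin : Summable fun K => if K < K₀ then B K else 0 := by
    refine summable_of_ne_finset_zero (s := Finset.range K₀) fun K hK => ?_
    rw [Finset.mem_range] at hK
    exact if_neg hK
  refine ⟨fun K => r K + (if K < K₀ then B K else 0), κ, hr.add hfin, fun K => add_nonneg (hr0 K) ?_, fun K V hV => ?_⟩
  · by_cases hK : K < K₀
    · rw [if_pos hK]; exact hB0 K
    · rw [if_neg hK]
  · show _ ≤ r K + (if K < K₀ then B K else 0)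
    by_cases hK : K < K₀
    · rw [if_pos hK]
      linarith [hBbd K V, hr0 K]
    · rw [if_neg hK, add_zero]
      exact h K (not_lt.mp hK) V hV

end Idle

/-! ## §5 The layer-3 reduction: `MinimiserStabilityAt ⇐` minimisers exist ∧ one-step bounds along minimisers -/

section Reduction

/-- **EXISTENCE OF CONSTRAINED MINIMISERS** (hypothesis schema, never asserted): from some `K₀` on, for every small datum `V` on
the comparison lattice (`n = ⌊K/m⌋`), the constrained minimal actions of run `K` AND of run `K+1` over the fibres of `V` are
ATTAINED.  For data in Bałaban's class this is [Balaban1985Variational] Thm 1 («there exists a minimal orbit in the space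
𝔘_k({Ω_j}, B₃ε₁) ∩ 𝔅_k(𝔅_k, V)», p.279) — for the minimum over the REGULAR subspace; for the full fibre of the tree's `minAction` it
is the located, unprinted statement that the global constrained minimum is attained (the fibres of the guarded printed averaging
are not closed, so compactness alone does not give it). [cite: Balaban1985Variational, Thm 1 p.279] -/
def HasMinimisersAt (F : T3Family) (γ b₀ p₀ : ℝ) (m : ℕ) : Prop :=
  ∃ K₀ : ℕ, ∀ K, K₀ ≤ K → ∀ (V : GaugeField (F.P (K / m)) 0 (Matrix.specialUnitaryGroup (Fin 2) ℂ)), PlaqSmall (θBal F.L γ b₀ p₀ (K / m)) V →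
    (∃ U ∈ fibre F ℰp (K / m) K (Nat.div_le_self K m) V,
        wilsonAction4 U = minAction F ℰp (K / m) K (Nat.div_le_self K m) V) ∧
      ∃ U' ∈ fibre F ℰp (K / m) (K + 1) ((Nat.div_le_self K m).trans (Nat.le_succ K)) V,
        wilsonAction4 U' = minAction F ℰp (K / m) (K + 1) ((Nat.div_le_self K m).trans (Nat.le_succ K)) V

/-- **ONE-STEP UPPER BOUND ALONG RUN-`K` MINIMISERS** (hypothesis schema, never asserted; the cell's INTERP node N6bI restricted
to minimisers): summable `r_K ≥ 0` and `K₀` such that for `K ≥ K₀` every constrained minimiser `U` of run `K` over the fibre of a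
small datum `V` admits a configuration `U'` of run `K+1` in the fibre of `V` (e.g. a one-step interpolation, `D_{K,K+1}U' = U`,
`T3DescentFibreTower.mem_fibre_trans`) with `β_{K+1}A(U') ≤ β_K A(U) + r_K` — a discretisation-error statement for REGULAR fields
([Balaban1985Variational] Thm 1 (8)–(10): the minimiser's plaquette variables and their covariant derivatives are
`B₃ε₁L^{−2j}`-small). [cite: Balaban1985Variational, Thm 1 (8)-(10) p.279] -/
def UpperAlongMinimisersAt (F : T3Family) (γ b₀ p₀ : ℝ) (m : ℕ) : Prop :=
  ∃ (K₀ : ℕ) (r : ℕ → ℝ), Summable r ∧ (∀ K, 0 ≤ r K) ∧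
    ∀ K, K₀ ≤ K → ∀ (V : GaugeField (F.P (K / m)) 0 (Matrix.specialUnitaryGroup (Fin 2) ℂ)), PlaqSmall (θBal F.L γ b₀ p₀ (K / m)) V →
      ∀ U ∈ fibre F ℰp (K / m) K (Nat.div_le_self K m) V,
        wilsonAction4 U = minAction F ℰp (K / m) K (Nat.div_le_self K m) V →
          ∃ U' ∈ fibre F ℰp (K / m) (K + 1) ((Nat.div_le_self K m).trans (Nat.le_succ K)) V,
            (F.scheme ℰp γ).β (K + 1) * wilsonAction4 U' ≤ (F.scheme ℰp γ).β K * wilsonAction4 U + r K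

/-- **ONE-STEP LOWER BOUND ALONG RUN-`(K+1)` MINIMISERS** (hypothesis schema, never asserted; the cell's AVG-INEQ node N6bA
restricted to minimisers): summable `r_K ≥ 0` and `K₀` such that for `K ≥ K₀` every constrained minimiser `U'` of run `K+1` over
the fibre of a small datum `V` admits a configuration `U` of run `K` in the fibre of `V` (e.g. its block average `D_{K,K+1}U'`,
`T3DescentFibreTower.descendTo_mem_fibre`) with `β_K A(U) ≤ β_{K+1}A(U') + r_K` — «averaging decreases the β-weighted action up
to a summable error» along regular fields (abelian, exact: [Federbush1986PhaseCellI] (0.12); non-abelian local stability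
[Federbush1987PhaseCellIII] Thm 4.3 (4.5), for a sibling averaging/action). [cite: Federbush1987PhaseCellIII, Thm 4.3 (4.5) p.299] -/
def LowerAlongMinimisersAt (F : T3Family) (γ b₀ p₀ : ℝ) (m : ℕ) : Prop :=
  ∃ (K₀ : ℕ) (r : ℕ → ℝ), Summable r ∧ (∀ K, 0 ≤ r K) ∧
    ∀ K, K₀ ≤ K → ∀ (V : GaugeField (F.P (K / m)) 0 (Matrix.specialUnitaryGroup (Fin 2) ℂ)), PlaqSmall (θBal F.L γ b₀ p₀ (K / m)) V →
      ∀ U' ∈ fibre F ℰp (K / m) (K + 1) ((Nat.div_le_self K m).trans (Nat.le_succ K)) V,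
        wilsonAction4 U' = minAction F ℰp (K / m) (K + 1) ((Nat.div_le_self K m).trans (Nat.le_succ K)) V →
          ∃ U ∈ fibre F ℰp (K / m) K (Nat.div_le_self K m) V,
            (F.scheme ℰp γ).β K * wilsonAction4 U ≤ (F.scheme ℰp γ).β (K + 1) * wilsonAction4 U' + r K

/-- **THE REDUCTION TO THE ROUTE'S CHILD** (`γ ≥ 0`): existence of constrained minimisers ∧ the one-step upper bound along run-`K`
minimisers ∧ the one-step lower bound along run-`(K+1)` minimisers ⇒ `T3ConstrainedMinimiser.MinimiserStabilityAt F γ b₀ p₀ m`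
with `κ ≡ 0` and radii `r_K + r'_K` from the larger threshold `K₀` on (`β_{K+1}minA_{K+1} ≤ β_{K+1}A(U') ≤ β_K A(U_K) + r = β_K minA_K + r`
and symmetrically; below `K₀` by `minimiserStabilityAt_of_eventually`). [cite: King1986, App. (A.5) p.676] -/
theorem minimiserStabilityAt_of_alongMinimisers (F : T3Family) {γ : ℝ} (hγ : 0 ≤ γ) {b₀ p₀ : ℝ} {m : ℕ}
    (hex : HasMinimisersAt F γ b₀ p₀ m) (hup : UpperAlongMinimisersAt F γ b₀ p₀ m)
    (hlow : LowerAlongMinimisersAt F γ b₀ p₀ m) : MinimiserStabilityAt F γ b₀ p₀ m := by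
  obtain ⟨K₁, hex⟩ := hex
  obtain ⟨K₂, r, hr, hr0, hup⟩ := hup
  obtain ⟨K₃, r', hr', hr0', hlow⟩ := hlow
  refine minimiserStabilityAt_of_eventually F hγ b₀ p₀ m (max K₁ (max K₂ K₃)) (fun K => r K + r' K) (fun _ => 0)
    (hr.add hr') (fun K => add_nonneg (hr0 K) (hr0' K)) fun K hK V hV => ?_
  have hK₁ : K₁ ≤ K := (le_max_left _ _).trans hK
  have hK₂ : K₂ ≤ K := ((le_max_left _ _).trans (le_max_right _ _)).trans hK
  have hK₃ : K₃ ≤ K := ((le_max_right _ _).trans (le_max_right _ _)).trans hK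
  obtain ⟨⟨U, hU, hUmin⟩, ⟨U', hU', hU'min⟩⟩ := hex K hK₁ V hV
  obtain ⟨W', hW', hupW⟩ := hup K hK₂ V hV U hU hUmin
  obtain ⟨W, hW, hlowW⟩ := hlow K hK₃ V hV U' hU' hU'min
  have hβ := F.scheme_β_nonneg ℰp hγ K
  have hβ' := F.scheme_β_nonneg ℰp hγ (K + 1)
  -- upper: β' minA' ≤ β' A(W') ≤ β A(U) + r = β minA + r
  have h1 : (F.scheme ℰp γ).β (K + 1) * minAction F ℰp (K / m) (K + 1) ((Nat.div_le_self K m).trans (Nat.le_succ K)) V ≤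
      (F.scheme ℰp γ).β K * minAction F ℰp (K / m) K (Nat.div_le_self K m) V + r K := by
    rw [← hUmin]
    exact (mul_le_mul_of_nonneg_left (minAction_le F ℰp hW') hβ').trans hupW
  -- lower: β minA ≤ β A(W) ≤ β' A(U') + r' = β' minA' + r'
  have h2 : (F.scheme ℰp γ).β K * minAction F ℰp (K / m) K (Nat.div_le_self K m) V ≤
      (F.scheme ℰp γ).β (K + 1) * minAction F ℰp (K / m) (K + 1) ((Nat.div_le_self K m).trans (Nat.le_succ K)) V + r' K := by
    rw [← hU'min]
    exact (mul_le_mul_of_nonneg_left (minAction_le F ℰp hW) hβ).trans hlowW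
  have := hr0 K
  have := hr0' K
  rw [sub_zero]
  exact abs_le.mpr ⟨by linarith, by linarith⟩

/-- The same all the way to K1's body: the three minimiser schemas ∧ `FluctuationComparisonAt` ⇒ `UnitTiltAt F γ b₀ p₀ m`
(p408691's `unitTiltAt_of_minimiser_fluctuation`). [cite: King1986, Thm 3.4 (3.9) p.656] -/
theorem unitTiltAt_of_alongMinimisers_fluctuation (F : T3Family) {γ : ℝ} (hγ : 0 ≤ γ) {b₀ p₀ : ℝ} {m : ℕ}
    (hex : HasMinimisersAt F γ b₀ p₀ m) (hup : UpperAlongMinimisersAt F γ b₀ p₀ m)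
    (hlow : LowerAlongMinimisersAt F γ b₀ p₀ m) (hfl : FluctuationComparisonAt F γ b₀ p₀ m) : UnitTiltAt F γ b₀ p₀ m :=
  unitTiltAt_of_minimiser_fluctuation F hγ b₀ p₀ m (minimiserStabilityAt_of_alongMinimisers F hγ hex hup hlow) hfl

end Reduction

end Literature.MathematicalPhysics.QuantumFieldTheory.Balaban1983to89.T3MinimiserStabilityReduction

end
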